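import Summits.AnomalousDissipation.AnomalousDissipation.Theorems.SolenoidalFractalHomogenisationLagrangianStepSidebandXDefectAlgebra
import HarnessLib

/-!
# K1L_D `LagrangianRenormalisationStepDesign` (stmt-AnomalousDissipation-27980), `stub_D1_V0` (V0 = clause (ii) of
# `WCrossing.D1ExactFamily`), brick T4c-3b (identity): THE COMMUTATOR DEFECT `genX(projX y) − projX(gen y)` COMPONENTWISE — viscous part, slow-coefficient
# part, projection-commutator part, augmentation remainder (helper; `--kind proof --supports stmt-AnomalousDissipation-27980 --as helper`)

Summits-side helper file of route `SolenoidalFractalHomogenisation` (prover seat `ad-k1l-cellLawV-w1` g6).  Everything proved; no definitions, no named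
facts, no sorry.  The first defect group `D1 = genX W₁ n ℓ 𝔹 γ₁ R t (projX n ℓ R y) − projX n ℓ R (gen W₁ 𝔸 γ₁' R t y)` of
`…SidebandXResidual.hasDerivWithinAt_residual` (memo `Cruxes/LagrangianRenormalisationStepDesign/Lines/onelevel-V0-residual.md` §2–§3) is written out per class
point `z` as an EXACT identity with no hypothesis on `y` (**`genX_projX_sub_projX_gen_apply`**):
`D1_z = −4π²•[P_k T_{𝔹ᵀ}(k) P_k y_z − P_k P_z T_{𝔸ᵀ}(z) P_z y_z]` (viscous; bounded by `…DefectAlgebra.abs_re_visc_defect_le` when `𝔹 = (1/n²)•𝔸`)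
` − Σⱼ linkCoeffⱼ(ℓ,t) • P_k(αⱼ P_{k⁻} y⁻ + ᾱⱼ P_{k⁺} y⁺)` (slow coefficient `ξⱼ·2πi·env`, `O(|ξ|)`; `…DefectAlgebra.linkCoeff_classFreq_eq_add`)
` − Σⱼ linkCoeffⱼ¹(z,t) • P_k(αⱼ (P_{k⁻} y⁻ − P_z P_{z−mⱼ} y⁻) + ᾱⱼ (P_{k⁺} y⁺ − P_z P_{z+mⱼ} y⁺))` (projection commutator)
` + γ₁' • P_k (y_z − P_z y_z)` (reference augmentation; vanishes for `z`-transversal `y`, `…SidebandResponseTransversal`),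
with `k = k_z = ℓ + n·z`, `k^∓ = k_{z∓mⱼ}`, `y^∓ = coordL_{z∓mⱼ} y`; plus `coordL_projX` and the elementary bound **`norm_sub_transversalProj_proj_le`**
`‖P_{k₀} v − P_k (P_{k₀} v)‖ ≤ (√|k−k₀|²/√|k|²)·‖v‖` (`k ≠ 0`) that, with `…DefectAlgebra.norm_transversalProj_sub_proj_le`, makes the commutator part `O(|ξ|)·‖y^∓‖`.
NOT a proof of any registered stub, of K1L_D, or of anomalous dissipation; rung F-D1.A0 infrastructure.
-/

set_option linter.dupNamespace false

noncomputable section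

namespace Summit.AnomalousDissipation.AnomalousDissipation.Theorems.SolenoidalFractalHomogenisation.LagrangianStep.Sideband

open Set MeasureTheory Complex UnitAddTorus
open scoped InnerProductSpace
open Literature.Analysis Literature.Analysis.FunctionSpaces Literature.Analysis.FunctionSpaces.Torus
open Literature.Analysis.FluidPDE Literature.Analysis.FluidPDE.Torus Literature.Analysis.FluidPDE.LatticeShear
open Summit.AnomalousDissipation.AnomalousDissipation.Theorems.SolenoidalFractalHomogenisation.LagrangianStep.CellChain (linkCoeff linkCoeff_def)

variable {k₀ : ℕ}

/-! ## §1 Reading the class projection through `coordL` -/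

/-- `coordL_w (projX y) = P_{k_w} (coordL_w y)` (both vanish off the box). [cite: Temam1984, Ch. III §1.1] -/
theorem coordL_projX {R : ℕ} (n : ℕ) (ℓ w : Fin 3 → ℤ) (y : Space R) :
    coordL R w (projX n ℓ R y) = transversalProj (classFreq n ℓ w) (coordL R w y) := by
  by_cases hw : w ∈ box R
  · rw [coordL_apply_of_mem hw, coordL_apply_of_mem hw, projX_apply]
  · rw [coordL_apply_of_not_mem hw, coordL_apply_of_not_mem hw, map_zero]

/-! ## §2 The commutator identity -/

/-- Linear bookkeeping of one link of the commutator (abstract; atoms are free variables). [folklore] -/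
theorem link_commutator_identity (P Q : EuclideanSpace ℂ (Fin 3) →L[ℂ] EuclideanSpace ℂ (Fin 3)) (c₁ c₀ α β : ℂ)
    (A A' B B' : EuclideanSpace ℂ (Fin 3)) :
    (c₁ + c₀) • P (α • A + β • B) - c₁ • P (Q (α • A' + β • B'))
      = c₀ • P (α • A + β • B) + c₁ • P (α • (A - Q A') + β • (B - Q B')) := by
  simp only [smul_add, map_add, map_smul, smul_sub, map_sub]
  module

/-- **THE COMMUTATOR DEFECT, COMPONENTWISE** (exact, no hypothesis on `y`): see the module docstring. [cite: MajdaKramer1999, §2.2.1.3 (cell problem (49))] -/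
theorem genX_projX_sub_projX_gen_apply (W₁ : LatticeWord k₀) {n : ℕ} (hn : n ≠ 0) (ℓ : Fin 3 → ℤ) (𝔹 𝔸 : Torus.Visc4 (Fin 3)) (γ₁ γ₁' : ℝ)
    {R : ℕ} (t : ℝ) (y : Space R) (z : box R) :
    (genX W₁ n ℓ 𝔹 γ₁ R t (projX n ℓ R y)) z - (projX n ℓ R (gen W₁ 𝔸 γ₁' R t y)) z
      = -((((4 * Real.pi ^ 2 : ℝ) : ℂ)) • (transversalProj (classFreq n ℓ z.1)
            (Torus.symbT (Torus.majorTranspose 𝔹) (classFreq n ℓ z.1) (transversalProj (classFreq n ℓ z.1) (y z))) -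
          transversalProj (classFreq n ℓ z.1) (transversalProj z.1
            (Torus.symbT (Torus.majorTranspose 𝔸) z.1 (transversalProj z.1 (y z))))))
        - ∑ j, linkCoeff W₁ n ℓ j t • transversalProj (classFreq n ℓ z.1)
            (slotAmp W₁ j • transversalProj (classFreq n ℓ (z.1 - (W₁.phase j).m)) (coordL R (z.1 - (W₁.phase j).m) y) +
              starRingEnd ℂ (slotAmp W₁ j) • transversalProj (classFreq n ℓ (z.1 + (W₁.phase j).m)) (coordL R (z.1 + (W₁.phase j).m) y))
        - ∑ j, linkCoeff W₁ 1 z.1 j t • transversalProj (classFreq n ℓ z.1)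
            (slotAmp W₁ j • (transversalProj (classFreq n ℓ (z.1 - (W₁.phase j).m)) (coordL R (z.1 - (W₁.phase j).m) y) -
                transversalProj z.1 (transversalProj (z.1 - (W₁.phase j).m) (coordL R (z.1 - (W₁.phase j).m) y))) +
              starRingEnd ℂ (slotAmp W₁ j) • (transversalProj (classFreq n ℓ (z.1 + (W₁.phase j).m)) (coordL R (z.1 + (W₁.phase j).m) y) -
                transversalProj z.1 (transversalProj (z.1 + (W₁.phase j).m) (coordL R (z.1 + (W₁.phase j).m) y))))
        + ((γ₁' : ℝ) : ℂ) • transversalProj (classFreq n ℓ z.1) (y z - transversalProj z.1 (y z)) := by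
  rw [genX_apply, genXComp_apply, projX_apply, gen_apply, genComp_apply, coordL_apply_of_mem z.2, coordL_apply_of_mem z.2, projX_apply,
    ThreeMode.transversalProj_idem, sub_self, smul_zero, sub_zero]
  simp only [coordL_projX, ThreeMode.transversalProj_idem, map_sub, map_neg, map_smul, map_sum]
  -- the links: split `linkCoeffⱼ(k_z) = linkCoeffⱼ¹(z) + linkCoeffⱼ(ℓ)` and regroup
  have hlink : ∀ j, linkCoeff W₁ n (classFreq n ℓ z.1) j t • transversalProj (classFreq n ℓ z.1)
        (slotAmp W₁ j • transversalProj (classFreq n ℓ (z.1 - (W₁.phase j).m)) (coordL R (z.1 - (W₁.phase j).m) y) +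
          starRingEnd ℂ (slotAmp W₁ j) • transversalProj (classFreq n ℓ (z.1 + (W₁.phase j).m)) (coordL R (z.1 + (W₁.phase j).m) y)) -
      linkCoeff W₁ 1 z.1 j t • transversalProj (classFreq n ℓ z.1) (transversalProj z.1
        (slotAmp W₁ j • transversalProj (z.1 - (W₁.phase j).m) (coordL R (z.1 - (W₁.phase j).m) y) +
          starRingEnd ℂ (slotAmp W₁ j) • transversalProj (z.1 + (W₁.phase j).m) (coordL R (z.1 + (W₁.phase j).m) y)))
      = linkCoeff W₁ n ℓ j t • transversalProj (classFreq n ℓ z.1)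
          (slotAmp W₁ j • transversalProj (classFreq n ℓ (z.1 - (W₁.phase j).m)) (coordL R (z.1 - (W₁.phase j).m) y) +
            starRingEnd ℂ (slotAmp W₁ j) • transversalProj (classFreq n ℓ (z.1 + (W₁.phase j).m)) (coordL R (z.1 + (W₁.phase j).m) y)) +
        linkCoeff W₁ 1 z.1 j t • transversalProj (classFreq n ℓ z.1)
          (slotAmp W₁ j • (transversalProj (classFreq n ℓ (z.1 - (W₁.phase j).m)) (coordL R (z.1 - (W₁.phase j).m) y) -
              transversalProj z.1 (transversalProj (z.1 - (W₁.phase j).m) (coordL R (z.1 - (W₁.phase j).m) y))) +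
            starRingEnd ℂ (slotAmp W₁ j) • (transversalProj (classFreq n ℓ (z.1 + (W₁.phase j).m)) (coordL R (z.1 + (W₁.phase j).m) y) -
              transversalProj z.1 (transversalProj (z.1 + (W₁.phase j).m) (coordL R (z.1 + (W₁.phase j).m) y)))) := by
    intro j
    rw [linkCoeff_classFreq_eq_add W₁ hn ℓ z.1 j t]
    exact link_commutator_identity _ _ _ _ _ _ _ _ _ _
  have hsum := Finset.sum_congr rfl fun j (_ : j ∈ (Finset.univ : Finset (Fin k₀))) => hlink j
  rw [Finset.sum_sub_distrib, Finset.sum_add_distrib] at hsum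
  have hX : (∑ j, linkCoeff W₁ n (classFreq n ℓ z.1) j t • transversalProj (classFreq n ℓ z.1)
        (slotAmp W₁ j • transversalProj (classFreq n ℓ (z.1 - (W₁.phase j).m)) (coordL R (z.1 - (W₁.phase j).m) y) +
          starRingEnd ℂ (slotAmp W₁ j) • transversalProj (classFreq n ℓ (z.1 + (W₁.phase j).m)) (coordL R (z.1 + (W₁.phase j).m) y)))
      = (∑ j, linkCoeff W₁ 1 z.1 j t • transversalProj (classFreq n ℓ z.1) (transversalProj z.1
        (slotAmp W₁ j • transversalProj (z.1 - (W₁.phase j).m) (coordL R (z.1 - (W₁.phase j).m) y) +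
          starRingEnd ℂ (slotAmp W₁ j) • transversalProj (z.1 + (W₁.phase j).m) (coordL R (z.1 + (W₁.phase j).m) y)))) +
        ((∑ j, linkCoeff W₁ n ℓ j t • transversalProj (classFreq n ℓ z.1)
          (slotAmp W₁ j • transversalProj (classFreq n ℓ (z.1 - (W₁.phase j).m)) (coordL R (z.1 - (W₁.phase j).m) y) +
            starRingEnd ℂ (slotAmp W₁ j) • transversalProj (classFreq n ℓ (z.1 + (W₁.phase j).m)) (coordL R (z.1 + (W₁.phase j).m) y))) +
        ∑ j, linkCoeff W₁ 1 z.1 j t • transversalProj (classFreq n ℓ z.1)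
          (slotAmp W₁ j • (transversalProj (classFreq n ℓ (z.1 - (W₁.phase j).m)) (coordL R (z.1 - (W₁.phase j).m) y) -
              transversalProj z.1 (transversalProj (z.1 - (W₁.phase j).m) (coordL R (z.1 - (W₁.phase j).m) y))) +
            starRingEnd ℂ (slotAmp W₁ j) • (transversalProj (classFreq n ℓ (z.1 + (W₁.phase j).m)) (coordL R (z.1 + (W₁.phase j).m) y) -
              transversalProj z.1 (transversalProj (z.1 + (W₁.phase j).m) (coordL R (z.1 + (W₁.phase j).m) y))))) := by
    rw [← hsum]; abel
  rw [hX]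
  simp only [smul_sub]
  abel

/-! ## §3 The longitudinal leak of a transversal vector at a nearby wave vector -/

/-- **`‖P_{k₀} v − P_k (P_{k₀} v)‖ ≤ (√|k − k₀|²/√|k|²)·‖v‖`** (`k ≠ 0`): a vector transversal at `k₀` has a longitudinal part at a nearby `k` of relative
size `|k − k₀|/|k|` (`k·(P_{k₀}v) = (k − k₀)·(P_{k₀}v)`). [cite: Temam1984, Ch. III §1.1] -/
theorem norm_sub_transversalProj_proj_le {k : Fin 3 → ℤ} (hk : k ≠ 0) (k₀ : Fin 3 → ℤ) (v : EuclideanSpace ℂ (Fin 3)) :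
    ‖transversalProj k₀ v - transversalProj k (transversalProj k₀ v)‖ ≤
      Real.sqrt (freqNormSq (k - k₀)) / Real.sqrt (freqNormSq k) * ‖v‖ := by
  have hF : 0 < freqNormSq k := freqNormSq_pos_of_ne_zero' hk
  have hsq : 0 < Real.sqrt (freqNormSq k) := Real.sqrt_pos.2 hF
  set w := transversalProj k₀ v with hw
  -- the longitudinal part at `k`
  have hlong : w - transversalProj k w = ((freqNormSq k : ℂ)⁻¹ * kdot k w) • waveVecC k := by
    rw [transversalProj_apply]; abel
  -- `k·w = (k − k₀)·w`
  have hkd : kdot k w = kdot (k - k₀) w := by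
    have h0 : kdot k₀ w = 0 := CellChain.kdot_transversalProj' k₀ v
    have : kdot k w = kdot (k - k₀) w + kdot k₀ w := by
      simp only [kdot_apply, Pi.sub_apply, Int.cast_sub, ← Finset.sum_add_distrib]
      refine Finset.sum_congr rfl fun i _ => ?_; ring
    rw [this, h0, add_zero]
  rw [hlong, norm_smul, norm_mul, norm_inv, Complex.norm_real, Real.norm_eq_abs, abs_of_pos hF, hkd, norm_waveVecC]
  have h1 := norm_kdot_le (k - k₀) w
  have h2 : ‖w‖ ≤ ‖v‖ := CellChain.norm_transversalProj_le k₀ v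
  have hsqF : Real.sqrt (freqNormSq k) * Real.sqrt (freqNormSq k) = freqNormSq k := Real.mul_self_sqrt hF.le
  have hinv : (freqNormSq k)⁻¹ * Real.sqrt (freqNormSq k) = (Real.sqrt (freqNormSq k))⁻¹ := by
    nth_rw 1 [← hsqF]
    rw [mul_inv, mul_assoc, inv_mul_cancel₀ hsq.ne', mul_one]
  calc (freqNormSq k)⁻¹ * ‖kdot (k - k₀) w‖ * Real.sqrt (freqNormSq k)
      ≤ (freqNormSq k)⁻¹ * (Real.sqrt (freqNormSq (k - k₀)) * ‖v‖) * Real.sqrt (freqNormSq k) := by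
        gcongr
        exact h1.trans (mul_le_mul_of_nonneg_left h2 (Real.sqrt_nonneg _))
    _ = ((freqNormSq k)⁻¹ * Real.sqrt (freqNormSq k)) * Real.sqrt (freqNormSq (k - k₀)) * ‖v‖ := by ring
    _ = Real.sqrt (freqNormSq (k - k₀)) / Real.sqrt (freqNormSq k) * ‖v‖ := by rw [hinv, div_eq_mul_inv]; ring

end Summit.AnomalousDissipation.AnomalousDissipation.Theorems.SolenoidalFractalHomogenisation.LagrangianStep.Sideband

end
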